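import Literature.AlgebraicGeometry.Motives.HodgeStructureLefschetzGroupPoints
import HarnessLib

/-!
# Milne 1999, Remark 1.6 ON POINTS for `k = ℚ ⊂ k' = K`: `S(H)(ℚ) = S(H)(K) ∩ GL(V)` and `G(H)(ℚ) = G(H)(K) ∩ GL(V)` under
# `g ↦ 1 ⊗ g`; the `ℚ`-points `G(H)(ℚ) ⊇ MT(H)(ℚ), S(H)(ℚ), ℚ^×` of Milne's `G(A)`

[topic AlgebraicGeometry/Motives]

Layer `Literature/AlgebraicGeometry/Motives`, lane `lit-hodgefound` (Track 2 foundations library; seat `lit-hodgefound-p34`,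
generation 19, FILE 2 of the self-proposed row g19-#4 of `run/shared/lean/pub/lit-hodgefound/SKELETON.md`; FILE 1 is
`Motives/HodgeStructureLefschetzGroupFieldExtension`, the same statements along a field extension `K → L`, not imported). ONE
definition WITH BODY (`Polarization.lefschetzSimilitudeGroup`, the `ℚ`-points `G(H)(ℚ) ≤ GL(V)` of Milne's `G(A)`, the companion of
g18-#1's `Polarization.lefschetzGroup = S(H)(ℚ)`) and THEOREMS; no named fact (net debt `0`). CARRIER: a pure `ℚ`-Hodge structure
`H` on `V` with a polarization `Q`; `S(H)(K)`, `G(H)(K)`, `S(H)(ℚ)` of g18-#1 `Motives/HodgeStructureLefschetzGroupPoints`; the base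
change of automorphisms `glBaseChange K V : GL(V) →* GL(K ⊗_ℚ V)`, `g ↦ g_K = 1 ⊗ g` (`Motives/EtaleTate`). g18-#1 proved only the
inclusion `S(H)(ℚ) ≤ (g ↦ g_K)⁻¹ S(H)(K)` (`lefschetzGroup_le_comap_lefschetzGroupBaseChange`); here the EQUALITY, and the same for
`G`.

## The source, verbatim

J. S. Milne, *Lefschetz classes on abelian varieties*, Duke Math. J. **96** (1999) 639–675 [Milne1999LefschetzClasses] (held
`paper:doi-10-1215-s0012-7094-99-09620-5` p0006 L16–L20 and L30–L38, p. 644; p0021 L10–L14, p. 659): "`S(A)(R) = {γ ∈ C(A) ⊗_k R |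
γ†γ = 1}` [for all commutative `k`-algebras `R`]"; "**Remark 1.6.** If `X ↦ H*(X)` is a Weil cohomology theory with coefficient
field `k`, and `k'` is a field containing `k`, then […] there are canonical isomorphisms `C'(A) ≅ C(A) ⊗_k k'`, `S'(A) ≅ S(A)_{/k'}`";
"`G(A)(R) = {γ ∈ C(A) ⊗ R | γ†γ ∈ R^×}`". For the Betti theory `k = ℚ`: the `ℚ`-points of `S(A)`, `G(A)` are the `K`-points that
are defined over `ℚ`.

## What is PROVED (`K ⊇ ℚ` a field, `g_K = glBaseChange K V g = 1 ⊗ g`)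

* §1 plumbing: `g` commutes with `a ∈ End_ℚ V` iff `g_K` commutes with `a_K` (`glBaseChange_baseChange_comm_iff`; "⟹" by
  `(a g)_K = a_K g_K`, "⟸" at `1 ⊗ v` by the injectivity of `v ↦ 1 ⊗ v`, Mathlib's `Module.Flat.tensorProduct_mk_injective`);
  `Q(g v, g w) = ν Q(v, w)` for all `v, w` iff `Q_K(g_K x, g_K y) = ν Q_K(x, y)` for all `x, y`
  (`forall_baseChange_glBaseChange_eq_mul_iff`, `ν ∈ ℚ ↦ (ℚ → K)(ν)`; "⟸" at pure tensors by the injectivity of `ℚ → K`).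
* §2 **`Polarization.glBaseChange_mem_lefschetzGroupBaseChange_iff : g_K ∈ S(H)(K) ↔ g ∈ S(H)(ℚ)`** and
  **`Polarization.lefschetzGroup_eq_comap_lefschetzGroupBaseChange : S(H)(ℚ) = (g ↦ g_K)⁻¹ S(H)(K)`** (the equality promised by
  g18-#1's `≤`), `map_… ≤`.
* §3 **DEF `Polarization.lefschetzSimilitudeGroup Q = G(H)(ℚ) ≤ GL(V)`** (the `g` commuting with `E_φ` with `Q(g v, g w) = ν Q(v, w)`,
  `ν ∈ ℚ^×`), `mem_…_iff`, `S(H)(ℚ) ≤ G(H)(ℚ)`, the homotheties `c · id ∈ G(H)(ℚ)` (`ν = c²`),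
  **`Polarization.glBaseChange_mem_lefschetzSimilitudeGroupBaseChange_iff : g_K ∈ G(H)(K) ↔ g ∈ G(H)(ℚ)`** (for "⟹" the multiplier
  of `g_K` is shown to be rational), **`Polarization.lefschetzSimilitudeGroup_eq_comap_… : G(H)(ℚ) = (g ↦ g_K)⁻¹ G(H)(K)`**,
  `map_… ≤`, and the consequences read off the `K`-points file: `G(H)(ℚ)` does not depend on `Q`
  (`lefschetzSimilitudeGroup_eq_of_polarization`) and **`MT(H)(ℚ) ≤ G(H)(ℚ)`** (`mumfordTateGroup_le_lefschetzSimilitudeGroup`).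

NOT here: the field-extension version `K → L` (FILE 1), the algebraic groups themselves.

## References

* [Milne1999LefschetzClasses] J. S. Milne, *Lefschetz classes on abelian varieties*, Duke Math. J. 96 (1999) 639–675, §1 p. 644
  L16–L20 (the group `S(A)`), Remark 1.6; §4 p. 659 L10–L20 (the group `G(A)`).
* [Deligne1982HodgeCycles] P. Deligne, *Hodge cycles on abelian varieties*, in LNM 900, Springer (1982), I §3.1 (points of
  algebraic groups over `ℚ`), proof of Prop. 3.6 (`MT ⊂ GSp`).
* [BourbakiAlgebraI1989] N. Bourbaki, *Algebra I*, Ch. II §5 no. 3 Prop. 7 (faithfulness of the extension of scalars over a field).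
-/

noncomputable section

open scoped TensorProduct

namespace Literature.AlgebraicGeometry.Motives

namespace HodgeStructure

universe u uK

variable (K : Type uK) [Field K] [Algebra ℚ K] {V : Type u} [AddCommGroup V] [Module ℚ V] {n : ℤ} {H : HodgeStructure V n}

/-! ## §1 Transport of the two defining conditions along `g ↦ g_K = 1 ⊗ g` -/

section Plumbing

/-- `v ↦ 1 ⊗ v : V → K ⊗_ℚ V` is injective (Mathlib's `Module.Flat.tensorProduct_mk_injective`; `ℚ → K` is a field extension).
Private plumbing. [folklore] -/
private theorem one_tmul_injective_pt : Function.Injective fun v : V ↦ (1 : K) ⊗ₜ[ℚ] v :=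
  Module.Flat.tensorProduct_mk_injective ℚ V K

omit H in
/-- **`g` commutes with `a` iff `g_K` commutes with `a_K`** (`a ∈ End_ℚ V`, `g ∈ GL(V)`): "⟹" is `(a g)_K = a_K g_K = g_K a_K = (g a)_K`,
"⟸" evaluates at `1 ⊗ v` and uses the injectivity of `v ↦ 1 ⊗ v`. [cite: Milne1999LefschetzClasses, §1 Remark 1.6 (p. 644) ("C'(A) ≅ C(A) ⊗_k k'")]
[cite: Deligne1982HodgeCycles, I §3.1] -/
theorem glBaseChange_baseChange_comm_iff (g : V ≃ₗ[ℚ] V) (a : Module.End ℚ V) :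
    (∀ x, a.baseChange K (glBaseChange K V g x) = glBaseChange K V g (a.baseChange K x)) ↔ ∀ v, a (g v) = g (a v) := by
  constructor
  · intro h v
    apply one_tmul_injective_pt K
    have hv := h ((1 : K) ⊗ₜ[ℚ] v)
    simp only [glBaseChange_apply, LinearEquiv.baseChange_tmul, LinearMap.baseChange_tmul] at hv
    exact hv
  · intro h x
    rw [glBaseChange_apply, ← LinearEquiv.coe_coe (g.baseChange ℚ K V V), LinearEquiv.coe_baseChange, ← LinearMap.comp_apply,
      ← LinearMap.comp_apply, ← LinearMap.baseChange_comp, ← LinearMap.baseChange_comp]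
    congr 2
    exact LinearMap.ext fun v ↦ h v

omit H in
/-- **`B(g v, g w) = ν B(v, w)` for all `v, w` iff `B_K(g_K x, g_K y) = ν B_K(x, y)` for all `x, y`** (`B` a `ℚ`-bilinear form,
`ν ∈ ℚ`): "⟹" on pure tensors by bilinearity, "⟸" at `1 ⊗ v`, `1 ⊗ w` by the injectivity of `ℚ → K`.
[cite: Milne1999LefschetzClasses, §1 Remark 1.6 (p. 644) and §4 p. 659 L10–L14] -/
theorem forall_baseChange_glBaseChange_eq_mul_iff (g : V ≃ₗ[ℚ] V) (B : LinearMap.BilinForm ℚ V) (ν : ℚ) :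
    (∀ x y, B.baseChange K (glBaseChange K V g x) (glBaseChange K V g y) = algebraMap ℚ K ν * B.baseChange K x y) ↔
      ∀ v w, B (g v) (g w) = ν * B v w := by
  constructor
  · intro h v w
    have key := h ((1 : K) ⊗ₜ[ℚ] v) ((1 : K) ⊗ₜ[ℚ] w)
    simp only [glBaseChange_apply, LinearEquiv.baseChange_tmul, LinearMap.BilinForm.baseChange_tmul, mul_one, Algebra.smul_def]
      at key
    rw [← map_mul] at key
    exact (algebraMap ℚ K).injective key
  · intro h x y
    rw [glBaseChange_apply]
    induction x using TensorProduct.induction_on with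
    | zero => simp only [map_zero, LinearMap.zero_apply, mul_zero]
    | add x x' hx hx' => rw [map_add, LinearMap.map_add₂, hx, hx', LinearMap.map_add₂, mul_add]
    | tmul c v =>
      induction y using TensorProduct.induction_on with
      | zero => simp only [map_zero, mul_zero]
      | add y y' hy hy' => rw [map_add, map_add, hy, hy', map_add, mul_add]
      | tmul d w =>
        rw [LinearEquiv.baseChange_tmul, LinearEquiv.baseChange_tmul, LinearMap.BilinForm.baseChange_tmul,
          LinearMap.BilinForm.baseChange_tmul, h, mul_smul, Algebra.smul_def ν]

omit H in
/-- The case `ν = 1`: `g` preserves `B` iff `g_K` preserves `B_K`. [cite: Milne1999LefschetzClasses, §1 Remark 1.6 (p. 644) and p. 644 L16–L20] -/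
theorem forall_baseChange_glBaseChange_eq_iff (g : V ≃ₗ[ℚ] V) (B : LinearMap.BilinForm ℚ V) :
    (∀ x y, B.baseChange K (glBaseChange K V g x) (glBaseChange K V g y) = B.baseChange K x y) ↔
      ∀ v w, B (g v) (g w) = B v w := by
  have h := forall_baseChange_glBaseChange_eq_mul_iff K g B 1
  simp only [map_one, one_mul] at h
  exact h

end Plumbing

/-! ## §2 `S(H)(ℚ) = S(H)(K) ∩ GL(V)` -/

section LefschetzGroup

variable (Q : Polarization H)

/-- **`g_K ∈ S(H)(K) ↔ g ∈ S(H)(ℚ)`**: the `ℚ`-points are the `K`-points defined over `ℚ` (the converse of g18-#1's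
`lefschetzGroup_le_comap_lefschetzGroupBaseChange`). [cite: Milne1999LefschetzClasses, §1 Remark 1.6 (p. 644) and p. 644 L16–L20] -/
theorem Polarization.glBaseChange_mem_lefschetzGroupBaseChange_iff (g : V ≃ₗ[ℚ] V) :
    glBaseChange K V g ∈ Q.lefschetzGroupBaseChange K ↔ g ∈ Q.lefschetzGroup := by
  rw [Polarization.mem_lefschetzGroupBaseChange_iff, Polarization.mem_lefschetzGroup_iff, forall_baseChange_glBaseChange_eq_iff]
  exact and_congr_left fun _ ↦ forall_congr' fun a ↦ glBaseChange_baseChange_comm_iff K g (a : Module.End ℚ V)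

/-- **`S(H)(ℚ) = (g ↦ g_K)⁻¹ S(H)(K)`** — "`S'(A) ≅ S(A)_{/k'}`" for `k = ℚ`, on points: the EQUALITY promised by g18-#1's inclusion.
[cite: Milne1999LefschetzClasses, §1 Remark 1.6 (p. 644)] -/
theorem Polarization.lefschetzGroup_eq_comap_lefschetzGroupBaseChange :
    Q.lefschetzGroup = (Q.lefschetzGroupBaseChange K).comap (glBaseChange K V) :=
  Subgroup.ext fun g ↦ (Q.glBaseChange_mem_lefschetzGroupBaseChange_iff K g).symm.trans Subgroup.mem_comap.symm

/-- `S(H)(ℚ)` maps into `S(H)(K)`. [cite: Milne1999LefschetzClasses, §1 Remark 1.6 (p. 644)] -/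
theorem Polarization.map_glBaseChange_lefschetzGroup_le :
    Q.lefschetzGroup.map (glBaseChange K V) ≤ Q.lefschetzGroupBaseChange K := by
  rw [Subgroup.map_le_iff_le_comap, ← Q.lefschetzGroup_eq_comap_lefschetzGroupBaseChange K]

end LefschetzGroup

/-! ## §3 The `ℚ`-points `G(H)(ℚ)` of Milne's `G(A)` and `G(H)(ℚ) = G(H)(K) ∩ GL(V)` -/

section LefschetzSimilitudeGroup

/-- An automorphism and its inverse in `GL(V)`: `g (g⁻¹ v) = v`. Private plumbing. [folklore] -/
private theorem gl_apply_inv_apply_rat {R : Type*} [CommSemiring R] {W : Type*} [AddCommMonoid W] [Module R W]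
    (γ : W ≃ₗ[R] W) (x : W) : γ (γ⁻¹ x) = x :=
  γ.apply_symm_apply x

/-- **Milne's `G(A)(k)` for `k = ℚ`: `G(H)(ℚ) ≤ GL(V)`**, the `g` commuting with every `a ∈ E_φ` ("`γ ∈ C(A)`") and multiplying
the polarization by a non-zero rational, `Q(g v, g w) = ν Q(v, w)` ("`γ†γ ∈ k^×`") — the `ℚ`-points companion of g18-#1's
`Polarization.lefschetzSimilitudeGroupBaseChange K Q = G(H)(K)`. Independent of `Q` (`lefschetzSimilitudeGroup_eq_of_polarization`).
[cite: Milne1999LefschetzClasses, §4 p. 659 L10–L14 (the group G(A))] -/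
def Polarization.lefschetzSimilitudeGroup (Q : Polarization H) : Subgroup (V ≃ₗ[ℚ] V) where
  carrier := {g | (∀ a : H.endAlg, ∀ v, (a : Module.End ℚ V) (g v) = g ((a : Module.End ℚ V) v)) ∧
    ∃ ν : ℚ, ν ≠ 0 ∧ ∀ v w, Q.form (g v) (g w) = ν * Q.form v w}
  one_mem' := ⟨fun _ _ ↦ rfl, 1, one_ne_zero, fun _ _ ↦ (one_mul _).symm⟩
  mul_mem' {g g'} hg hg' := by
    obtain ⟨ν, hν, h⟩ := hg.2
    obtain ⟨ν', hν', h'⟩ := hg'.2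
    exact ⟨fun a v ↦ by rw [LinearEquiv.mul_apply, LinearEquiv.mul_apply, hg.1 a, hg'.1 a],
      ν * ν', mul_ne_zero hν hν', fun v w ↦ by rw [LinearEquiv.mul_apply, LinearEquiv.mul_apply, h, h', mul_assoc]⟩
  inv_mem' {g} hg := by
    obtain ⟨ν, hν, h⟩ := hg.2
    refine ⟨fun a v ↦ g.injective (by rw [gl_apply_inv_apply_rat, ← hg.1 a, gl_apply_inv_apply_rat]), ν⁻¹, inv_ne_zero hν,
      fun v w ↦ ?_⟩
    conv_rhs => rw [← gl_apply_inv_apply_rat g v, ← gl_apply_inv_apply_rat g w, h]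
    rw [← mul_assoc, inv_mul_cancel₀ hν, one_mul]

variable (Q Q' : Polarization H)

/-- Membership in `G(H)(ℚ)`. [cite: Milne1999LefschetzClasses, §4 p. 659 L10–L14] -/
theorem Polarization.mem_lefschetzSimilitudeGroup_iff (g : V ≃ₗ[ℚ] V) :
    g ∈ Q.lefschetzSimilitudeGroup ↔
      (∀ a : H.endAlg, ∀ v, (a : Module.End ℚ V) (g v) = g ((a : Module.End ℚ V) v)) ∧
        ∃ ν : ℚ, ν ≠ 0 ∧ ∀ v w, Q.form (g v) (g w) = ν * Q.form v w :=
  Iff.rfl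

/-- `S(H)(ℚ) ≤ G(H)(ℚ)` (`ν = 1`). [cite: Milne1999LefschetzClasses, §4 p. 659 L28–L31 ("the kernel of l(A) […] equals S(A)")] -/
theorem Polarization.lefschetzGroup_le_lefschetzSimilitudeGroup : Q.lefschetzGroup ≤ Q.lefschetzSimilitudeGroup := fun _ hg ↦
  ⟨hg.1, 1, one_ne_zero, fun v w ↦ by rw [hg.2, one_mul]⟩

/-- The homothety `c · id` (`c ∈ ℚ^×`) lies in `G(H)(ℚ)`, with multiplier `c²` ("`a ↦ (a⁻¹, a⁻²) : 𝔾_m → L(A)`", on `ℚ`-points).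
[cite: Milne1999LefschetzClasses, §4 p. 659 L31–L34] -/
theorem Polarization.smulOfUnit_mem_lefschetzSimilitudeGroup (c : ℚˣ) :
    LinearEquiv.smulOfUnit c ∈ Q.lefschetzSimilitudeGroup := by
  refine ⟨fun a v ↦ ?_, (c : ℚ) * c, mul_ne_zero c.ne_zero c.ne_zero, fun v w ↦ ?_⟩
  · change (a : Module.End ℚ V) (c • v) = c • (a : Module.End ℚ V) v
    rw [Units.smul_def, Units.smul_def, map_smul]
  · change Q.form (c • v) (c • w) = _
    rw [Units.smul_def, Units.smul_def, LinearMap.map_smul₂, LinearMap.map_smul, smul_eq_mul, smul_eq_mul, mul_assoc]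

/-- **`g_K ∈ G(H)(K) ↔ g ∈ G(H)(ℚ)`**: the `ℚ`-points of `G` are the `K`-points defined over `ℚ`. "⟸": the multiplier `ν ∈ ℚ`
becomes `ν ∈ K`; "⟹": the multiplier `ν'` of `g_K` is rational — `ν' = Q(g v₀, g w₀) / Q(v₀, w₀)` for any `v₀, w₀` with
`Q(v₀, w₀) ≠ 0` (and `V = 0` otherwise). [cite: Milne1999LefschetzClasses, §1 Remark 1.6 (p. 644) and §4 p. 659 L10–L14] -/
theorem Polarization.glBaseChange_mem_lefschetzSimilitudeGroupBaseChange_iff (g : V ≃ₗ[ℚ] V) :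
    glBaseChange K V g ∈ Q.lefschetzSimilitudeGroupBaseChange K ↔ g ∈ Q.lefschetzSimilitudeGroup := by
  rw [Polarization.mem_lefschetzSimilitudeGroupBaseChange_iff, Polarization.mem_lefschetzSimilitudeGroup_iff]
  constructor
  · rintro ⟨hc, ν', hν', hm'⟩
    refine ⟨fun a ↦ (glBaseChange_baseChange_comm_iff K g (a : Module.End ℚ V)).1 (hc a), ?_⟩
    by_cases hQ : ∃ v w, Q.form v w ≠ 0
    · obtain ⟨v₀, w₀, h₀⟩ := hQ
      -- the multiplier of `g_K` is the rational number `Q(g v₀, g w₀) / Q(v₀, w₀)`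
      have hν : algebraMap ℚ K (Q.form (g v₀) (g w₀) / Q.form v₀ w₀) = ν' := by
        have h1 := hm' ((1 : K) ⊗ₜ[ℚ] v₀) ((1 : K) ⊗ₜ[ℚ] w₀)
        simp only [glBaseChange_apply, LinearEquiv.baseChange_tmul, LinearMap.BilinForm.baseChange_tmul, mul_one,
          Algebra.smul_def] at h1
        rw [map_div₀, h1, mul_div_assoc, div_self ((map_ne_zero (algebraMap ℚ K)).2 h₀), mul_one]
      refine ⟨Q.form (g v₀) (g w₀) / Q.form v₀ w₀, fun h ↦ hν' ?_,
        (forall_baseChange_glBaseChange_eq_mul_iff K g Q.form _).1 fun x y ↦ by rw [hν]; exact hm' x y⟩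
      rw [← hν, h, map_zero]
    · simp only [not_exists, not_not] at hQ
      exact ⟨1, one_ne_zero, fun v w ↦ by rw [hQ, hQ, mul_zero]⟩
  · rintro ⟨hc, ν, hν, hm⟩
    exact ⟨fun a ↦ (glBaseChange_baseChange_comm_iff K g (a : Module.End ℚ V)).2 (hc a), algebraMap ℚ K ν,
      (map_ne_zero (algebraMap ℚ K)).2 hν, (forall_baseChange_glBaseChange_eq_mul_iff K g Q.form ν).2 hm⟩

/-- **`G(H)(ℚ) = (g ↦ g_K)⁻¹ G(H)(K)`** ("`G(A)_{/k'}`" for `k = ℚ`, on points). [cite: Milne1999LefschetzClasses, §1 Remark 1.6 (p. 644) and §4 p. 659] -/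
theorem Polarization.lefschetzSimilitudeGroup_eq_comap_lefschetzSimilitudeGroupBaseChange :
    Q.lefschetzSimilitudeGroup = (Q.lefschetzSimilitudeGroupBaseChange K).comap (glBaseChange K V) :=
  Subgroup.ext fun g ↦ (Q.glBaseChange_mem_lefschetzSimilitudeGroupBaseChange_iff K g).symm.trans Subgroup.mem_comap.symm

/-- `G(H)(ℚ)` maps into `G(H)(K)`. [cite: Milne1999LefschetzClasses, §1 Remark 1.6 (p. 644) and §4 p. 659] -/
theorem Polarization.map_glBaseChange_lefschetzSimilitudeGroup_le :
    Q.lefschetzSimilitudeGroup.map (glBaseChange K V) ≤ Q.lefschetzSimilitudeGroupBaseChange K := by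
  rw [Subgroup.map_le_iff_le_comap, ← Q.lefschetzSimilitudeGroup_eq_comap_lefschetzSimilitudeGroupBaseChange K]

variable [Module.Finite ℚ V] [HodgeTensorFacts.{u, u}]

/-- **`G(H)(ℚ)` does not depend on the polarization** (read off the `K = ℚ` points of g18-#1's
`lefschetzSimilitudeGroupBaseChange_eq_of_polarization`). [cite: Milne1999LefschetzClasses, §4 p. 659 L10–L20 and §1 p. 642] -/
theorem Polarization.lefschetzSimilitudeGroup_eq_of_polarization : Q.lefschetzSimilitudeGroup = Q'.lefschetzSimilitudeGroup := by
  rw [Q.lefschetzSimilitudeGroup_eq_comap_lefschetzSimilitudeGroupBaseChange ℚ,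
    Q'.lefschetzSimilitudeGroup_eq_comap_lefschetzSimilitudeGroupBaseChange ℚ, Q.lefschetzSimilitudeGroupBaseChange_eq_of_polarization ℚ Q']

/-- **`MT(H)(ℚ) ≤ G(H)(ℚ)`** (Deligne: `MT ⊂ GSp`; Milne: `L(A) ⊃ Hg(A)`), read off the `K = ℚ` points: `g ∈ MT(H)(ℚ)` has
`g_ℚ ∈ MT(H)(ℚ ⊗ V) ≤ G(H)(ℚ ⊗ V)` (the tree's `mumfordTateGroup_le_comap` and g18-#1's
`mumfordTateGroupBaseChange_le_lefschetzSimilitudeGroupBaseChange`). [cite: Milne1999LefschetzClasses, §4 p. 660 ("L(A) ⊃ Hg(A)")]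
[cite: Deligne1982HodgeCycles, I Prop. 3.6 (proof)] -/
theorem Polarization.mumfordTateGroup_le_lefschetzSimilitudeGroup : H.mumfordTateGroup ≤ Q.lefschetzSimilitudeGroup := by
  intro g hg
  rw [Q.lefschetzSimilitudeGroup_eq_comap_lefschetzSimilitudeGroupBaseChange ℚ, Subgroup.mem_comap]
  exact Q.mumfordTateGroupBaseChange_le_lefschetzSimilitudeGroupBaseChange ℚ (mumfordTateGroup_le_comap ℚ H hg)

/-- `Hg(H)(ℚ) ≤ G(H)(ℚ)` (through `S(H)(ℚ)`, g18-#1's `hodgeGroup_le_lefschetzGroup`). [cite: Milne1999LefschetzClasses, §4 p. 660 ("L(A) ⊃ Hg(A)")] -/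
theorem Polarization.hodgeGroup_le_lefschetzSimilitudeGroup : H.hodgeGroup ≤ Q.lefschetzSimilitudeGroup :=
  Q.hodgeGroup_le_lefschetzGroup.trans Q.lefschetzGroup_le_lefschetzSimilitudeGroup

end LefschetzSimilitudeGroup

end HodgeStructure

end Literature.AlgebraicGeometry.Motives

end
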